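import Summits.CriticalPhenomena.CardyFormulaZ2.Theorems.CardyUniqueLimitCardyRigidityFarFieldEta

/-!
# The far-field expansion of the modulus of three perturbed marks (line `crossing-martingale`, crux `CardyRigidity`)

Deterministic combination lemma of the far-field MOMENT engine (stubs `stub_betaPinning` /
`stub_kernelAffineBeta`, crux `CardyRigidity`, stmt-CriticalPhenomena-0746).  In the far field
the three rescaled marks of a regular driving process at time `t` and scale `n` are
`Pᵢ = x̂ᵢ + r/x̂ᵢ - s + εᵢ` with the deterministic drift `r = 2t/n²`, the common random shift
`s = W_t/n` and errors `εᵢ = O(K/n³)` (`FarFieldFlow`).  Writing `x̂' = (x̂ᵢ + r/x̂ᵢ)ᵢ` for the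
drifted base triple (again admissible) and `S₁' = S₁(x̂')`, `b' = x̂'₁`, the modulus satisfies

  `|η(P) - η(x̂) - (η(x̂') - η(x̂)) + S₁' s + (S₁'/b') s²| ≤ 2 (S₁'/b'²) |s|³ + L (|ε₀| + |ε₁| + |ε₂|)`

(`abs_cardyEta_perturbed_sub_le`): the `ε`-part by the Lipschitz bound on the box around `x̂`
(`FarField.abs_cardyEta_sub_le_of_box`), the `s`-part by the exact Möbius expansion at the base
`x̂'` (`FarField.abs_cardyEta_sub_remainder_le`).  The deterministic sequence `η(x̂'_n) - η(x̂)`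
carries the drift coefficient (`2t S₂/n² + o(n⁻²)`, `FarFieldEta` docstring); taking expectations
of the displayed inequality against the `L³` domination gives the moment asymptotics.
-/

noncomputable section

open Set Filter Topology
open Literature.Probability.RandomPlanarGeometry

namespace Summit.CriticalPhenomena.CardyFormulaZ2.Cruxes.CardyRigidity.CrossingMartingale

namespace FarField

/-- The drifted base triple `(a + r/a, b + r/b, c + r/c)` is admissible and close to `(a, b, c)`
when `0 ≤ r` and `r/a ≤ a/4`. [folklore] -/
theorem drifted_base_bounds {a b c r : ℝ} (ha : 0 < a) (hab : a < b) (hbc : b < c) (hr : 0 ≤ r)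
    (hra : r / a ≤ a / 4) :
    0 < a + r / a ∧ a + r / a < b + r / b ∧ b + r / b < c + r / c ∧
      b ≤ b + r / b ∧ b + r / b ≤ 5 * b / 4 ∧
      |a + r / a - a| ≤ r / a ∧ |b + r / b - b| ≤ r / a ∧ |c + r / c - c| ≤ r / a := by
  have hb : 0 < b := ha.trans hab
  have hc : 0 < c := hb.trans hbc
  have hra' : r / a ≤ a / 4 := hra
  have hrb : r / b ≤ r / a := div_le_div_of_nonneg_left hr ha hab.le
  have hrc : r / c ≤ r / b := div_le_div_of_nonneg_left hr hb hbc.le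
  have hrb0 : 0 ≤ r / b := div_nonneg hr hb.le
  have hrc0 : 0 ≤ r / c := div_nonneg hr hc.le
  have hra0 : 0 ≤ r / a := div_nonneg hr ha.le
  -- `r/a - r/b = r (b-a)/(ab) < b - a` since `r/(ab) ≤ a/(4b) < 1`
  have hr4 : r ≤ a ^ 2 / 4 := by
    have h := (div_le_iff₀ ha).1 hra'
    nlinarith [h]
  have hrab : r < a * b := by nlinarith
  have hrbc : r < b * c := by nlinarith
  have h1 : r / a - r / b < b - a := by
    have key : r / a - r / b = r * (b - a) / (a * b) := by field_simp
    rw [key, div_lt_iff₀ (mul_pos ha hb)]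
    have hba : 0 < b - a := by linarith
    calc r * (b - a) < a * b * (b - a) := by gcongr
      _ = (b - a) * (a * b) := by ring
  have h2 : r / b - r / c < c - b := by
    have key : r / b - r / c = r * (c - b) / (b * c) := by field_simp
    rw [key, div_lt_iff₀ (mul_pos hb hc)]
    have hcb : 0 < c - b := by linarith
    calc r * (c - b) < b * c * (c - b) := by gcongr
      _ = (c - b) * (b * c) := by ring
  refine ⟨by positivity, by linarith, by linarith, by linarith, ?_, ?_, ?_, ?_⟩
  · have : r / b ≤ b / 4 := hrb.trans (hra.trans (by linarith))
    linarith
  · rw [show a + r / a - a = r / a by ring, abs_of_nonneg hra0]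
  · rw [show b + r / b - b = r / b by ring, abs_of_nonneg hrb0]; exact hrb
  · rw [show c + r / c - c = r / c by ring, abs_of_nonneg hrc0]; exact hrc.trans hrb

/-- **The far-field expansion of the modulus of three perturbed marks.**  For `0 < a < b < c`,
`0 ≤ r`, and perturbations with `r/a + |s| + |εᵢ| ≤ ρ ≤ min(a, b-a, c-b)/4` for each `i`, with the
drifted base `a' = a + r/a`, `b' = b + r/b`, `c' = c + r/c` and `S₁' = (b'-a')(c'-b')/(b'²(c'-a'))`:
`|η(a'-s+ε₀, b'-s+ε₁, c'-s+ε₂) - η(a',b',c') + S₁' s + (S₁'/b') s²| ≤ 2 (S₁'/b'²)|s|³ + L Σ|εᵢ|`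
with `L` the Lipschitz constant of `abs_cardyEta_sub_le_of_box` at `(a, b, c)`. [folklore] -/
theorem abs_cardyEta_perturbed_sub_le {a b c r s ε₀ ε₁ ε₂ ρ : ℝ} (ha : 0 < a) (hab : a < b)
    (hbc : b < c) (hr : 0 ≤ r) (hρ : ρ ≤ min (min a (b - a)) (c - b) / 4)
    (h₀ : r / a + |s| + |ε₀| ≤ ρ) (h₁ : r / a + |s| + |ε₁| ≤ ρ) (h₂ : r / a + |s| + |ε₂| ≤ ρ) :
    |cardyEta (a + r / a - s + ε₀) (b + r / b - s + ε₁) (c + r / c - s + ε₂)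
        - cardyEta (a + r / a) (b + r / b) (c + r / c)
        + (b + r / b - (a + r / a)) * (c + r / c - (b + r / b)) /
            ((b + r / b) ^ 2 * (c + r / c - (a + r / a))) * s
        + (b + r / b - (a + r / a)) * (c + r / c - (b + r / b)) /
            ((b + r / b) ^ 2 * (c + r / c - (a + r / a))) / (b + r / b) * s ^ 2| ≤
      2 * ((b + r / b - (a + r / a)) * (c + r / c - (b + r / b)) /
            ((b + r / b) ^ 2 * (c + r / c - (a + r / a)))) / (b + r / b) ^ 2 * |s| ^ 3 +
        (10 * c * (c - b) / (b * (c - a) ^ 2) + 6 * a * c / (b ^ 2 * (c - a)) +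
          10 * a * (b - a) / (b * (c - a) ^ 2)) * (|ε₀| + |ε₁| + |ε₂|) := by
  have hρa : ρ ≤ a / 4 := hρ.trans (by
    have := min_le_left (min a (b - a)) (c - b); have := min_le_left a (b - a); linarith)
  have habs : 0 ≤ |s| := abs_nonneg s
  have hra : r / a ≤ a / 4 := by linarith [abs_nonneg ε₀]
  obtain ⟨ha', hab', hbc', hbb', -, hda, hdb, hdc⟩ := drifted_base_bounds ha hab hbc hr hra
  -- the Möbius part at the drifted base
  have hs : |s| ≤ (b + r / b) / 2 := by
    have : |s| ≤ a / 4 := by linarith [abs_nonneg ε₀, div_nonneg hr ha.le]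
    linarith
  have hM := abs_cardyEta_sub_remainder_le ha' hab' hbc' hs
  -- the Lipschitz part on the box around `(a, b, c)`
  have hra0 : 0 ≤ r / a := div_nonneg hr ha.le
  have hP : ∀ {x e : ℝ} {y : ℝ}, |x - y| ≤ r / a → r / a + |s| + |e| ≤ ρ → |x - s + e - y| ≤ ρ := by
    intro x e y hx he
    calc |x - s + e - y| = |(x - y) + (-s) + e| := by ring_nf
      _ ≤ |x - y| + |-s| + |e| := abs_add_three _ _ _
      _ ≤ r / a + |s| + |e| := by rw [abs_neg]; linarith
      _ ≤ ρ := he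
  have hQ : ∀ {x : ℝ} {y : ℝ}, |x - y| ≤ r / a → r / a + |s| + |ε₀| ≤ ρ → |x - s - y| ≤ ρ := by
    intro x y hx he
    calc |x - s - y| = |(x - y) + (-s)| := by ring_nf
      _ ≤ |x - y| + |-s| := abs_add_le _ _
      _ ≤ r / a + |s| := by rw [abs_neg]; linarith
      _ ≤ ρ := by linarith [abs_nonneg ε₀]
  have hL := abs_cardyEta_sub_le_of_box ha hab hbc hρ
    (p₀ := a + r / a - s) (p₁ := b + r / b - s) (p₂ := c + r / c - s)
    (q₀ := a + r / a - s + ε₀) (q₁ := b + r / b - s + ε₁) (q₂ := c + r / c - s + ε₂)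
    (hQ hda h₀) (hQ hdb h₀) (hQ hdc h₀) (hP hda h₀) (hP hdb h₁) (hP hdc h₂)
  have e0 : a + r / a - s + ε₀ - (a + r / a - s) = ε₀ := by ring
  have e1 : b + r / b - s + ε₁ - (b + r / b - s) = ε₁ := by ring
  have e2 : c + r / c - s + ε₂ - (c + r / c - s) = ε₂ := by ring
  rw [e0, e1, e2] at hL
  -- combine with the triangle inequality
  have key := abs_add_le
    (cardyEta (a + r / a - s + ε₀) (b + r / b - s + ε₁) (c + r / c - s + ε₂)
      - cardyEta (a + r / a - s) (b + r / b - s) (c + r / c - s))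
    (cardyEta (a + r / a - s) (b + r / b - s) (c + r / c - s) - cardyEta (a + r / a) (b + r / b) (c + r / c)
      + (b + r / b - (a + r / a)) * (c + r / c - (b + r / b)) /
          ((b + r / b) ^ 2 * (c + r / c - (a + r / a))) * s
      + (b + r / b - (a + r / a)) * (c + r / c - (b + r / b)) /
          ((b + r / b) ^ 2 * (c + r / c - (a + r / a))) / (b + r / b) * s ^ 2)
  have heq : cardyEta (a + r / a - s + ε₀) (b + r / b - s + ε₁) (c + r / c - s + ε₂)
      - cardyEta (a + r / a - s) (b + r / b - s) (c + r / c - s) +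
      (cardyEta (a + r / a - s) (b + r / b - s) (c + r / c - s) - cardyEta (a + r / a) (b + r / b) (c + r / c)
        + (b + r / b - (a + r / a)) * (c + r / c - (b + r / b)) /
            ((b + r / b) ^ 2 * (c + r / c - (a + r / a))) * s
        + (b + r / b - (a + r / a)) * (c + r / c - (b + r / b)) /
            ((b + r / b) ^ 2 * (c + r / c - (a + r / a))) / (b + r / b) * s ^ 2) =
      cardyEta (a + r / a - s + ε₀) (b + r / b - s + ε₁) (c + r / c - s + ε₂)
        - cardyEta (a + r / a) (b + r / b) (c + r / c)
        + (b + r / b - (a + r / a)) * (c + r / c - (b + r / b)) /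
            ((b + r / b) ^ 2 * (c + r / c - (a + r / a))) * s
        + (b + r / b - (a + r / a)) * (c + r / c - (b + r / b)) /
            ((b + r / b) ^ 2 * (c + r / c - (a + r / a))) / (b + r / b) * s ^ 2 := by ring
  rw [heq] at key
  linarith [hL, hM, key]

/-! ### The drift family `r ↦ η(a + r/a, b + r/b, c + r/c)` and the coefficient `S₂` -/

/-- **Derivative of the modulus along the Loewner drift of the marks** at `r = 0`:
`d/dr η(a + r/a, b + r/b, c + r/c)|₀ = S₂ = S₁ (ab + bc + ca)/(abc)`, `S₁ = (b-a)(c-b)/(b²(c-a))`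
(this is `Σᵢ ∂ᵢη/x̂ᵢ`, the first-order coefficient of the deterministic drift `2t/(n² x̂ᵢ)`).
[folklore] -/
theorem hasDerivAt_cardyEta_drift {a b c : ℝ} (ha : 0 < a) (hab : a < b) (hbc : b < c) :
    HasDerivAt (fun r ↦ cardyEta (a + r / a) (b + r / b) (c + r / c))
      ((b - a) * (c - b) / (b ^ 2 * (c - a)) * ((a * b + b * c + c * a) / (a * b * c))) 0 := by
  have hb : 0 < b := ha.trans hab
  have hc : 0 < c := hb.trans hbc
  have hca : 0 < c - a := by linarith
  -- numerator and denominator as functions of `r`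
  have hN : HasDerivAt (fun r : ℝ ↦ (a + r / a) * (c + r / c - (b + r / b)))
      (1 / a * (c + 0 / c - (b + 0 / b)) + (a + 0 / a) * (1 / c - 1 / b)) 0 := by
    have h1 : HasDerivAt (fun r : ℝ ↦ a + r / a) (1 / a) 0 := by
      simpa using ((hasDerivAt_id (0 : ℝ)).div_const a).const_add a
    have h2 : HasDerivAt (fun r : ℝ ↦ c + r / c - (b + r / b)) (1 / c - 1 / b) 0 := by
      have hc' := ((hasDerivAt_id (0 : ℝ)).div_const c).const_add c
      have hb' := ((hasDerivAt_id (0 : ℝ)).div_const b).const_add b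
      exact hc'.sub hb'
    exact h1.mul h2
  have hD : HasDerivAt (fun r : ℝ ↦ (b + r / b) * (c + r / c - (a + r / a)))
      (1 / b * (c + 0 / c - (a + 0 / a)) + (b + 0 / b) * (1 / c - 1 / a)) 0 := by
    have h1 : HasDerivAt (fun r : ℝ ↦ b + r / b) (1 / b) 0 := by
      simpa using ((hasDerivAt_id (0 : ℝ)).div_const b).const_add b
    have h2 : HasDerivAt (fun r : ℝ ↦ c + r / c - (a + r / a)) (1 / c - 1 / a) 0 := by
      have hc' := ((hasDerivAt_id (0 : ℝ)).div_const c).const_add c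
      have ha' := ((hasDerivAt_id (0 : ℝ)).div_const a).const_add a
      exact hc'.sub ha'
    exact h1.mul h2
  have hD0 : (b + 0 / b) * (c + 0 / c - (a + 0 / a)) ≠ 0 := by
    simp only [zero_div, add_zero]; exact (mul_pos hb hca).ne'
  have hquot := hN.div hD hD0
  have hfun : (fun r ↦ cardyEta (a + r / a) (b + r / b) (c + r / c)) =
      fun r ↦ (a + r / a) * (c + r / c - (b + r / b)) / ((b + r / b) * (c + r / c - (a + r / a))) := by
    funext r; rfl
  rw [hfun]
  refine hquot.congr_deriv ?_
  simp only [zero_div, add_zero]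
  field_simp
  ring

/-- The slope of the drift family at `0` tends to `S₂`. [folklore] -/
theorem tendsto_cardyEta_drift_slope {a b c : ℝ} (ha : 0 < a) (hab : a < b) (hbc : b < c) :
    Tendsto (fun r ↦ r⁻¹ * (cardyEta (a + r / a) (b + r / b) (c + r / c) - cardyEta a b c))
      (𝓝[≠] 0) (𝓝 ((b - a) * (c - b) / (b ^ 2 * (c - a)) * ((a * b + b * c + c * a) / (a * b * c)))) := by
  have h := (hasDerivAt_cardyEta_drift ha hab hbc).tendsto_slope_zero
  simp only [zero_add, zero_div, add_zero, smul_eq_mul] at h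
  exact h

/-- The translation coefficient `S₁` of the drifted base tends to `S₁(a, b, c)` as `r → 0`.
[folklore] -/
theorem tendsto_S₁_drift {a b c : ℝ} (ha : 0 < a) (hab : a < b) (hbc : b < c) :
    Tendsto (fun r ↦ (b + r / b - (a + r / a)) * (c + r / c - (b + r / b)) /
        ((b + r / b) ^ 2 * (c + r / c - (a + r / a)))) (𝓝 0)
      (𝓝 ((b - a) * (c - b) / (b ^ 2 * (c - a)))) := by
  have hb : 0 < b := ha.trans hab
  have hca : 0 < c - a := by linarith
  have hcont : ContinuousAt (fun r : ℝ ↦ (b + r / b - (a + r / a)) * (c + r / c - (b + r / b)) /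
      ((b + r / b) ^ 2 * (c + r / c - (a + r / a)))) 0 := by
    refine ContinuousAt.div (by fun_prop) (by fun_prop) ?_
    simp only [zero_div, add_zero]
    exact (mul_pos (pow_pos hb 2) hca).ne'
  have := hcont.tendsto
  simpa using this

/-- The middle coordinate of the drifted base tends to `b` as `r → 0`. [folklore] -/
theorem tendsto_mid_drift (b : ℝ) : Tendsto (fun r : ℝ ↦ b + r / b) (𝓝 0) (𝓝 b) := by
  have : ContinuousAt (fun r : ℝ ↦ b + r / b) 0 := by fun_prop
  simpa using this.tendsto

/-- **Registered form** (glue sub-goal `farField_hasDerivAt_cardyEta_drift` of stmt-CriticalPhenomena-0746):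
the drift coefficient `S₂ = S₁ (ab+bc+ca)/(abc)` of the modulus. [folklore] -/
theorem farField_hasDerivAt_cardyEta_drift : ∀ {a b c : ℝ}, 0 < a → a < b → b < c → HasDerivAt (fun r ↦ cardyEta (a + r / a) (b + r / b) (c + r / c)) ((b - a) * (c - b) / (b ^ 2 * (c - a)) * ((a * b + b * c + c * a) / (a * b * c))) 0 :=
  fun ha hab hbc ↦ hasDerivAt_cardyEta_drift ha hab hbc

end FarField

end Summit.CriticalPhenomena.CardyFormulaZ2.Cruxes.CardyRigidity.CrossingMartingale

end
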